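import Mathlib.RingTheory.Polynomial.Cyclotomic.Roots
import Mathlib.RingTheory.Polynomial.Cyclotomic.Expand
import Mathlib.RingTheory.Polynomial.Cyclotomic.Eval
import Mathlib.RingTheory.AdjoinRoot
import Mathlib.RingTheory.RootsOfUnity.Complex
import Mathlib.FieldTheory.KummerExtension
import Mathlib.NumberTheory.Wilson
import HarnessLib

/-!
# The order `ℤ[ζ_{4p}] = ℤ[X]/(Φ_{4p})`: the prime `𝔓 = (p, ζ_{4p} − s)` above `p`, its reduction map, and the units
# `p/(1 + ζ²)^{p−1}`, `ρ(1 + ζ²)/(1 + ζ²)`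

COR-CM (cell `pub-hodgecm2`), binder seat b04 (gen 25), count-neutral claim CYCLIC-SEMIDIRECT-EIGHT, part IIIa: the
elementary arithmetic of `Λ = ℤ[X]/(Φ_{4p})` needed by the norm descent of part IIIb (`CorCM/CyclotomicFourPNormDescent`:
«`±i` is not a norm from `ℚ(ζ_{4p})` to `ℚ(i, ζ_p + ζ_p⁻¹)` when `p ≡ 5 (mod 8)`»).  Mathlib only.  KERNEL ONLY: theorems; no
definition, no named fact, no `sorry`.

Throughout `p` is a prime with `p ≡ 1 (mod 4)`, `Λ = AdjoinRoot (cyclotomic (4p) ℤ)` with generator `μ`, `ζ = e^{2πi/4p} ∈ ℂ`,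
`g = 1 + μ²`, `η = −μ²` (a primitive `p`-th root of unity), `s ∈ 𝔽_p` with `s² = −1`.

* §1 `ev` — the evaluation `Λ → ℂ`, `μ ↦ ζ`, is injective (`Φ_{4p}` is the minimal polynomial of `ζ` over the integrally
  closed ring `ℤ`): `aeval_eq_zero_iff`, `isPrimitiveRoot_root`, `root_pow_eq_neg_one` (`μ^{2p} = −1`),
  `isPrimitiveRoot_eta` (`η = −μ²` is a primitive `p`-th root), `aeval_root_pow_cyclotomic` (`Φ_{4p}(μ^a) = 0` for
  `a` coprime to `4p`).
* §2 `prime_eq_prod` (`p = ∏_{j=1}^{p−1} (1 − η^j)`), **`prime_eq_pow_mul`** (`p = g^{p−1}·ε`, `ε = ∏_j (1 + η + ⋯ + η^{j−1})`).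
* §3 `eval₂_cyclotomic_four_mul` and the reduction `π_s : Λ → 𝔽_p`, `μ ↦ s`: `lift_root_pow`, `ringHom_ext`,
  `lift_eps_ne_zero` (`π_s(ε) = (p−1)! ≠ 0`), **`exists_eq_mul_of_lift_eq_zero`** (`π_s Z = π_{−s} Z = 0 ⟹ g ∣ Z`).

## References

* [Washington1997] L. C. Washington, *Introduction to Cyclotomic Fields*, Lemma 1.4, Prop. 2.8 (`p = u(1−ζ)^{p−1}`), Thm. 2.13.
* [FeinGordonSmith1971] B. Fein, B. Gordon, J. H. Smith, J. Number Theory 3 (1971), 310–315 (local obstructions to `−1`,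
  `±i` being norms in cyclotomic towers).

Provenance: Literature home (family `hodge`, namespace `Literature.NumberTheory.NumberFields.CyclotomicFourP`) of the Summits-side `CorCM/CyclotomicFourPIntegers` (cell `pub-hodgecm2`, COR-CM; all its imports are `Literature/` and Mathlib), which `Literature/` may not import; theorems only, no named fact, no definition. Nothing here bears on `HC_CM`. Lane `lit-hodgefound` (Layer A3: CM types, their Kubota ranks and Galois combinatorics), seat p20.
-/

noncomputable section

open Polynomial

namespace Literature.NumberTheory.NumberFields.CyclotomicFourP

variable {p : ℕ}

/-! ## §1 The evaluation `ℤ[X]/(Φ_{4p}) → ℂ` and its consequences -/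

section Eval

/-- `ζ = e^{2πi/4p}` is a root of `Φ_{4p}`, read through `ℤ → ℂ`. [cite: Washington1997, Lemma 1.4] -/
theorem eval₂_cyclotomic_exp (hp : 0 < p) :
    (cyclotomic (4 * p) ℤ).eval₂ (algebraMap ℤ ℂ) (Complex.exp (2 * Real.pi * Complex.I / (4 * p : ℕ))) = 0 := by
  have hζ := Complex.isPrimitiveRoot_exp (4 * p) (by omega)
  haveI : NeZero (4 * p) := ⟨by omega⟩
  rw [eval₂_eq_eval_map, map_cyclotomic, ← IsRoot.def, isRoot_cyclotomic_iff]
  exact hζ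

/-- **`Φ_{4p}` is the minimal polynomial of `ζ`: `P(ζ) = 0 ⟺ Φ_{4p} ∣ P` — i.e. the evaluation `ℤ[X]/(Φ_{4p}) → ℂ` is
injective.** [cite: Washington1997, Lemma 1.4] -/
theorem mk_eq_zero_of_aeval_eq_zero (hp : 0 < p) (P : ℤ[X])
    (hP : aeval (Complex.exp (2 * Real.pi * Complex.I / (4 * p : ℕ))) P = 0) :
    AdjoinRoot.mk (cyclotomic (4 * p) ℤ) P = 0 := by
  have hζ := Complex.isPrimitiveRoot_exp (4 * p) (by omega)
  rw [AdjoinRoot.mk_eq_zero, cyclotomic_eq_minpoly hζ (by omega)]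
  exact minpoly.isIntegrallyClosed_dvd (hζ.isIntegral (by omega)) hP

/-- The evaluation map on classes: `ev(P mod Φ_{4p}) = P(ζ)`. [cite: Washington1997, Lemma 1.4] -/
theorem lift_exp_mk (hp : 0 < p) (P : ℤ[X]) :
    AdjoinRoot.lift (algebraMap ℤ ℂ) _ (eval₂_cyclotomic_exp hp) (AdjoinRoot.mk (cyclotomic (4 * p) ℤ) P) =
      aeval (Complex.exp (2 * Real.pi * Complex.I / (4 * p : ℕ))) P := by
  rw [AdjoinRoot.lift_mk, aeval_def]

/-- **Injectivity of the evaluation.** [cite: Washington1997, Lemma 1.4] -/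
theorem lift_exp_injective (hp : 0 < p) :
    Function.Injective (AdjoinRoot.lift (algebraMap ℤ ℂ) _ (eval₂_cyclotomic_exp hp) :
      AdjoinRoot (cyclotomic (4 * p) ℤ) →+* ℂ) := by
  refine (injective_iff_map_eq_zero _).2 fun Z hZ => ?_
  induction Z using AdjoinRoot.induction_on with
  | ih P =>
    rw [lift_exp_mk hp] at hZ
    exact mk_eq_zero_of_aeval_eq_zero hp P hZ

/-- `μ = X mod Φ_{4p}` is a primitive `4p`-th root of unity in the domain `ℤ[X]/(Φ_{4p})`. [cite: Washington1997, Lemma 1.4] -/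
theorem isPrimitiveRoot_root (hp : 0 < p) : IsPrimitiveRoot (AdjoinRoot.root (cyclotomic (4 * p) ℤ)) (4 * p) := by
  refine IsPrimitiveRoot.of_map_of_injective (f := AdjoinRoot.lift (algebraMap ℤ ℂ) _ (eval₂_cyclotomic_exp hp)) ?_
    (lift_exp_injective hp)
  rw [AdjoinRoot.lift_root]
  exact Complex.isPrimitiveRoot_exp (4 * p) (by omega)

/-- `Λ = ℤ[X]/(Φ_{4p})` is a domain. [cite: Washington1997, Lemma 1.4] -/
theorem isDomain (hp : 0 < p) : IsDomain (AdjoinRoot (cyclotomic (4 * p) ℤ)) :=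
  AdjoinRoot.isDomain_of_prime (cyclotomic.irreducible (by omega)).prime

/-- `μ^{2p} = −1`. [cite: Washington1997, Lemma 1.4] -/
theorem root_pow_eq_neg_one (hp : 0 < p) : AdjoinRoot.root (cyclotomic (4 * p) ℤ) ^ (2 * p) = -1 := by
  haveI := isDomain hp
  have hμ := isPrimitiveRoot_root hp
  have h1 : (AdjoinRoot.root (cyclotomic (4 * p) ℤ) ^ (2 * p)) ^ 2 = 1 := by
    rw [← pow_mul, show 2 * p * 2 = 4 * p by ring, hμ.pow_eq_one]
  have hne : AdjoinRoot.root (cyclotomic (4 * p) ℤ) ^ (2 * p) ≠ 1 := by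
    intro h
    have := hμ.dvd_of_pow_eq_one _ h
    have := Nat.le_of_dvd (by omega) this
    omega
  have h1' : AdjoinRoot.root (cyclotomic (4 * p) ℤ) ^ (2 * p) * AdjoinRoot.root (cyclotomic (4 * p) ℤ) ^ (2 * p) = 1 := by
    rw [← pow_two]; exact h1
  rcases mul_self_eq_one_iff.1 h1' with h | h
  · exact absurd h hne
  · exact h

/-- **`η = −μ²` is a primitive `p`-th root of unity** (`p` odd). [cite: Washington1997, Lemma 1.4] -/
theorem isPrimitiveRoot_eta (hp : p.Prime) (hp2 : p ≠ 2) :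
    IsPrimitiveRoot (-(AdjoinRoot.root (cyclotomic (4 * p) ℤ)) ^ 2) p := by
  haveI := isDomain hp.pos
  haveI : Fact p.Prime := ⟨hp⟩
  have hμ := isPrimitiveRoot_root hp.pos
  have hodd : Odd p := hp.odd_of_ne_two hp2
  have hηp : (-(AdjoinRoot.root (cyclotomic (4 * p) ℤ)) ^ 2) ^ p = 1 := by
    rw [neg_pow, hodd.neg_one_pow, ← pow_mul, root_pow_eq_neg_one hp.pos, neg_mul, one_mul, neg_neg]
  have hη1 : -(AdjoinRoot.root (cyclotomic (4 * p) ℤ)) ^ 2 ≠ 1 := by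
    intro h
    have h2 : AdjoinRoot.root (cyclotomic (4 * p) ℤ) ^ 2 = -1 := neg_eq_iff_eq_neg.1 h
    have h4 : AdjoinRoot.root (cyclotomic (4 * p) ℤ) ^ 4 = 1 := by
      rw [show AdjoinRoot.root (cyclotomic (4 * p) ℤ) ^ 4 = (AdjoinRoot.root (cyclotomic (4 * p) ℤ) ^ 2) ^ 2 by ring,
        h2, neg_one_sq]
    have := Nat.le_of_dvd (by norm_num) (hμ.dvd_of_pow_eq_one 4 h4)
    have := hp.two_le
    omega
  have hord : orderOf (-(AdjoinRoot.root (cyclotomic (4 * p) ℤ)) ^ 2) = p := orderOf_eq_prime hηp hη1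
  have key := IsPrimitiveRoot.orderOf (-(AdjoinRoot.root (cyclotomic (4 * p) ℤ)) ^ 2)
  rwa [hord] at key

/-- `Φ_{4p}(μ^a) = 0` in `Λ` for `a` coprime to `4p` (pulled back from `ℂ`). [cite: Washington1997, Lemma 1.4] -/
theorem eval₂_root_pow_cyclotomic (hp : 0 < p) {a : ℕ} (ha : a.Coprime (4 * p)) :
    (cyclotomic (4 * p) ℤ).eval₂ (algebraMap ℤ (AdjoinRoot (cyclotomic (4 * p) ℤ)))
      (AdjoinRoot.root (cyclotomic (4 * p) ℤ) ^ a) = 0 := by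
  apply lift_exp_injective hp
  haveI : NeZero (4 * p) := ⟨by omega⟩
  have hζa := (Complex.isPrimitiveRoot_exp (4 * p) (by omega)).pow_of_coprime a ha
  rw [map_zero, hom_eval₂, map_pow, AdjoinRoot.lift_root, eval₂_eq_eval_map, ← IsRoot.def]
  have : ((AdjoinRoot.lift (algebraMap ℤ ℂ) (Complex.exp (2 * Real.pi * Complex.I / (4 * p : ℕ)))
      (eval₂_cyclotomic_exp hp)).comp (algebraMap ℤ (AdjoinRoot (cyclotomic (4 * p) ℤ)))) = algebraMap ℤ ℂ :=
    Subsingleton.elim _ _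
  rw [this, map_cyclotomic, isRoot_cyclotomic_iff]
  exact hζa

/-- Two ring maps out of `ℤ[X]/(f)` that agree on the root agree. [cite: Washington1997, Lemma 1.4] -/
theorem ringHom_ext {f : ℤ[X]} {T : Type*} [CommRing T] {φ₁ φ₂ : AdjoinRoot f →+* T}
    (h : φ₁ (AdjoinRoot.root f) = φ₂ (AdjoinRoot.root f)) : φ₁ = φ₂ := by
  have key : φ₁.toIntAlgHom = φ₂.toIntAlgHom := AdjoinRoot.algHom_ext h
  exact RingHom.ext fun z => DFunLike.congr_fun key z

end Eval

/-! ## §2 `p = (1 + μ²)^{p−1} · ε` with `π(ε) = (p−1)!` -/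

section Units

/-- **`p = ∏_{j=1}^{p−1} (1 − η^j)`** for the primitive `p`-th root `η = −μ²` in the domain `Λ`
(`X^p − 1 = ∏_{j<p} (X − η^j)`, divide by `X − 1`, evaluate at `1`). [cite: Washington1997, Lemma 1.4] -/
theorem prime_eq_prod (hp : p.Prime) (hp2 : p ≠ 2) :
    ((p : ℕ) : AdjoinRoot (cyclotomic (4 * p) ℤ)) =
      ∏ j ∈ Finset.range (p - 1), (1 - (-(AdjoinRoot.root (cyclotomic (4 * p) ℤ)) ^ 2) ^ (j + 1)) := by
  haveI := isDomain hp.pos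
  haveI : Fact p.Prime := ⟨hp⟩
  set η := -(AdjoinRoot.root (cyclotomic (4 * p) ℤ)) ^ 2 with hη_def
  have hη := isPrimitiveRoot_eta hp hp2
  -- `X^p - 1 = ∏_{j<p} (X - η^j) = (X - 1) · ∏_{j<p-1} (X - η^{j+1})`
  have hprod := X_pow_sub_C_eq_prod (R := AdjoinRoot (cyclotomic (4 * p) ℤ)) hη hp.pos (one_pow p)
  simp only [map_one, mul_one] at hprod
  have hr : Finset.range p = Finset.range (p - 1 + 1) := by rw [Nat.sub_add_cancel hp.one_le]
  rw [hr, Finset.prod_range_succ', pow_zero, map_one] at hprod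
  -- compare with `X^p - 1 = Φ_p · (X - 1)`
  have hcyc := cyclotomic_prime_mul_X_sub_one (AdjoinRoot (cyclotomic (4 * p) ℤ)) p
  rw [hprod] at hcyc
  have hX1 : (X - 1 : (AdjoinRoot (cyclotomic (4 * p) ℤ))[X]) ≠ 0 := X_sub_C_ne_zero 1
  have hΦ : cyclotomic p (AdjoinRoot (cyclotomic (4 * p) ℤ)) =
      ∏ j ∈ Finset.range (p - 1), (X - C (η ^ (j + 1))) := mul_right_cancel₀ hX1 hcyc
  -- evaluate at `1`
  have h1 := congrArg (eval 1) hΦ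
  rw [eval_one_cyclotomic_prime, eval_prod] at h1
  simp only [eval_sub, eval_X, eval_C] at h1
  exact h1

/-- **`p = (1 + μ²)^{p−1} · ε`, `ε = ∏_{j=1}^{p−1} (1 + η + ⋯ + η^{j−1})`** (`1 − η^j = (1 − η)(1 + ⋯ + η^{j−1})`,
`1 − η = 1 + μ²`). [cite: Washington1997, Prop. 2.8] -/
theorem prime_eq_pow_mul (hp : p.Prime) (hp2 : p ≠ 2) :
    ((p : ℕ) : AdjoinRoot (cyclotomic (4 * p) ℤ)) =
      (1 + AdjoinRoot.root (cyclotomic (4 * p) ℤ) ^ 2) ^ (p - 1) *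
        ∏ j ∈ Finset.range (p - 1), ∑ m ∈ Finset.range (j + 1), (-(AdjoinRoot.root (cyclotomic (4 * p) ℤ)) ^ 2) ^ m := by
  rw [prime_eq_prod hp hp2]
  have hfac : ∀ j : ℕ, (1 - (-(AdjoinRoot.root (cyclotomic (4 * p) ℤ)) ^ 2) ^ (j + 1)) =
      (1 + AdjoinRoot.root (cyclotomic (4 * p) ℤ) ^ 2) *
        ∑ m ∈ Finset.range (j + 1), (-(AdjoinRoot.root (cyclotomic (4 * p) ℤ)) ^ 2) ^ m := fun j => by
    rw [← mul_neg_geom_sum, sub_neg_eq_add]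
  simp_rw [hfac]
  rw [Finset.prod_mul_distrib, Finset.prod_const, Finset.card_range]

/-- `1 + μ² ≠ 0` in `Λ`. [cite: Washington1997, Lemma 1.4] -/
theorem one_add_root_sq_ne_zero (hp : p.Prime) (hp2 : p ≠ 2) :
    (1 + AdjoinRoot.root (cyclotomic (4 * p) ℤ) ^ 2) ≠ 0 := by
  haveI := isDomain hp.pos
  intro h
  have hp0 : ((p : ℕ) : AdjoinRoot (cyclotomic (4 * p) ℤ)) = 0 := by
    rw [prime_eq_pow_mul hp hp2, h, zero_pow (by have := hp.two_le; omega), zero_mul]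
  have hinj := lift_exp_injective hp.pos
  have := congrArg (AdjoinRoot.lift (algebraMap ℤ ℂ) _ (eval₂_cyclotomic_exp hp.pos)) hp0
  rw [map_natCast, map_zero, Nat.cast_eq_zero] at this
  exact hp.ne_zero this

/-- `ρ(1 + μ²) = 1 + μ^{2(2p−1)} = (1 + μ²)·ε₂` with `ε₂ = 1 + η + ⋯ + η^{p−2}`, and `ε₂ · (−η) = 1`. [cite: Washington1997, Lemma 1.4] -/
theorem one_add_root_pow_eq (hp : p.Prime) (hp2 : p ≠ 2) :
    1 + (AdjoinRoot.root (cyclotomic (4 * p) ℤ) ^ (2 * p - 1)) ^ 2 =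
      (1 + AdjoinRoot.root (cyclotomic (4 * p) ℤ) ^ 2) *
        ∑ m ∈ Finset.range (p - 1), (-(AdjoinRoot.root (cyclotomic (4 * p) ℤ)) ^ 2) ^ m ∧
    (∑ m ∈ Finset.range (p - 1), (-(AdjoinRoot.root (cyclotomic (4 * p) ℤ)) ^ 2) ^ m) *
        (-(-(AdjoinRoot.root (cyclotomic (4 * p) ℤ)) ^ 2)) = 1 := by
  haveI := isDomain hp.pos
  set μ := AdjoinRoot.root (cyclotomic (4 * p) ℤ) with hμ_def
  set η := -μ ^ 2 with hη_def
  have hη := isPrimitiveRoot_eta hp hp2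
  have hev : Even (p - 1) := hp.even_sub_one hp2
  have h2p := root_pow_eq_neg_one hp.pos
  have h2 := hp.two_le
  -- `(μ^{2p-1})² = μ^{4p-2} = -μ^{2p-2} = -η^{p-1}`
  have hsq : (μ ^ (2 * p - 1)) ^ 2 = -η ^ (p - 1) := by
    rw [hη_def, neg_pow, hev.neg_one_pow, one_mul, ← pow_mul, ← pow_mul,
      show (2 * p - 1) * 2 = 2 * p + 2 * (p - 1) by omega, pow_add, h2p, neg_one_mul]
  -- `Σ_{m<p} η^m = 0`
  have hgeom : ∑ m ∈ Finset.range p, η ^ m = 0 := hη.geom_sum_eq_zero hp.one_lt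
  have hgeom' : ∑ m ∈ Finset.range (p - 1), η ^ m = -η ^ (p - 1) := by
    have hr : Finset.range p = Finset.range (p - 1 + 1) := by rw [Nat.sub_add_cancel hp.one_le]
    rw [hr, Finset.sum_range_succ] at hgeom
    linear_combination hgeom
  refine ⟨?_, ?_⟩
  · rw [hsq, ← sub_eq_add_neg, ← mul_neg_geom_sum, hη_def, sub_neg_eq_add]
  · rw [hgeom', neg_mul_neg, ← pow_succ, Nat.sub_add_cancel hp.one_le, hη.pow_eq_one]

end Units

/-! ## §3 The reduction `π_s : Λ → 𝔽_p`, `μ ↦ s` (`s² = −1`) -/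

section Reduction

/-- `Φ_{4p}(s) = 0` in `𝔽_p` when `s² = −1`: `Φ_{4p} ≡ (X² + 1)^{p−1} (mod p)`. [cite: Washington1997, Thm. 2.13] -/
theorem eval₂_cyclotomic_four_mul (hp : p.Prime) (hp2 : p ≠ 2) {s : ZMod p} (hs : s ^ 2 = -1) :
    (cyclotomic (4 * p) ℤ).eval₂ (Int.castRingHom (ZMod p)) s = 0 := by
  haveI : Fact p.Prime := ⟨hp⟩
  have h4 : ¬ p ∣ 4 := fun h => by
    have h' : p ∣ 2 ^ 2 := by simpa using h
    exact hp2 ((Nat.prime_dvd_prime_iff_eq hp Nat.prime_two).1 (hp.dvd_of_dvd_pow h'))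
  have hcyc4 : cyclotomic 4 (ZMod p) = X ^ 2 + 1 := by
    have := cyclotomic_prime_pow_eq_geom_sum (R := ZMod p) (n := 1) Nat.prime_two
    rw [show 2 ^ (1 + 1) = 4 by norm_num, Finset.sum_range_succ, Finset.sum_range_one, pow_zero, pow_one, pow_one]
      at this
    rw [this, add_comm]
  rw [eval₂_eq_eval_map, map_cyclotomic_int, cyclotomic_mul_prime_eq_pow_of_not_dvd (ZMod p) h4, hcyc4, eval_pow,
    eval_add, eval_pow, eval_X, eval_one, hs, neg_add_cancel, zero_pow]
  have := hp.two_le; omega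

/-- `π_s(μ^k) = s^k`; in particular `π_s(η) = 1`. [cite: Washington1997, Lemma 1.4] -/
theorem lift_eta (hp : p.Prime) (hp2 : p ≠ 2) {s : ZMod p} (hs : s ^ 2 = -1) :
    AdjoinRoot.lift (Int.castRingHom (ZMod p)) s (eval₂_cyclotomic_four_mul hp hp2 hs)
      (-(AdjoinRoot.root (cyclotomic (4 * p) ℤ)) ^ 2) = 1 := by
  rw [map_neg, map_pow, AdjoinRoot.lift_root, hs, neg_neg]

/-- **`π_s(ε) = (p−1)! ≠ 0`**: each factor `1 + η + ⋯ + η^{j−1}` reduces to `j`. [cite: Washington1997, Lemma 1.4] -/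
theorem lift_eps_ne_zero (hp : p.Prime) (hp2 : p ≠ 2) {s : ZMod p} (hs : s ^ 2 = -1) :
    AdjoinRoot.lift (Int.castRingHom (ZMod p)) s (eval₂_cyclotomic_four_mul hp hp2 hs)
      (∏ j ∈ Finset.range (p - 1), ∑ m ∈ Finset.range (j + 1), (-(AdjoinRoot.root (cyclotomic (4 * p) ℤ)) ^ 2) ^ m)
      ≠ 0 := by
  haveI : Fact p.Prime := ⟨hp⟩
  rw [map_prod]
  have hfac : ∀ j : ℕ, AdjoinRoot.lift (Int.castRingHom (ZMod p)) s (eval₂_cyclotomic_four_mul hp hp2 hs)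
      (∑ m ∈ Finset.range (j + 1), (-(AdjoinRoot.root (cyclotomic (4 * p) ℤ)) ^ 2) ^ m) = ((j + 1 : ℕ) : ZMod p) :=
    fun j => by
      rw [map_sum]
      simp_rw [map_pow, lift_eta hp hp2 hs, one_pow]
      simp
  simp_rw [hfac]
  rw [← Nat.cast_prod, Finset.prod_range_add_one_eq_factorial, ZMod.wilsons_lemma]
  exact neg_ne_zero.2 one_ne_zero

/-- **The kernel of `(π_s, π_{−s})` is `(1 + μ²)Λ`**: if `P(s) = P(−s) = 0` in `𝔽_p` then `P mod Φ_{4p}` is divisible by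
`1 + μ²` (`X² + 1 = (X − s)(X + s)` divides `P mod p`, and `p ∈ (1 + μ²)Λ`). [cite: Washington1997, Thm. 2.13] -/
theorem exists_eq_mul_of_lift_eq_zero (hp : p.Prime) (hp2 : p ≠ 2) {s : ZMod p} (hs : s ^ 2 = -1)
    (hs' : (-s) ^ 2 = -1) (Z : AdjoinRoot (cyclotomic (4 * p) ℤ))
    (h₁ : AdjoinRoot.lift (Int.castRingHom (ZMod p)) s (eval₂_cyclotomic_four_mul hp hp2 hs) Z = 0)
    (h₂ : AdjoinRoot.lift (Int.castRingHom (ZMod p)) (-s) (eval₂_cyclotomic_four_mul hp hp2 hs') Z = 0) :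
    ∃ Z' : AdjoinRoot (cyclotomic (4 * p) ℤ), Z = (1 + AdjoinRoot.root (cyclotomic (4 * p) ℤ) ^ 2) * Z' := by
  haveI : Fact p.Prime := ⟨hp⟩
  induction Z using AdjoinRoot.induction_on with
  | ih P =>
  rw [AdjoinRoot.lift_mk] at h₁ h₂
  -- `P mod p` vanishes at `s` and `-s`, hence is divisible by `X² + 1 = (X - s)(X + s)`
  set Pbar : (ZMod p)[X] := P.map (Int.castRingHom (ZMod p)) with hPbar
  have hr₁ : Pbar.IsRoot s := by rw [IsRoot.def, hPbar, eval_map, h₁]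
  have hr₂ : Pbar.IsRoot (-s) := by rw [IsRoot.def, hPbar, eval_map, h₂]
  obtain ⟨Q₁, hQ₁⟩ := dvd_iff_isRoot.2 hr₁
  have hs0 : s ≠ 0 := by rintro rfl; norm_num at hs
  have h2s : -s - s ≠ 0 := by
    rw [show -s - s = -(2 * s) by ring, neg_ne_zero, mul_ne_zero_iff]
    refine ⟨?_, hs0⟩
    rw [Ne, show (2 : ZMod p) = ((2 : ℕ) : ZMod p) by norm_num, ZMod.natCast_eq_zero_iff]
    exact fun h => hp2 ((Nat.prime_dvd_prime_iff_eq hp Nat.prime_two).1 h)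
  have hQ₁r : Q₁.IsRoot (-s) := by
    have := hr₂
    rw [hQ₁, IsRoot.def, eval_mul, eval_sub, eval_X, eval_C] at this
    exact (mul_eq_zero.1 this).resolve_left h2s
  obtain ⟨Q₂, hQ₂⟩ := dvd_iff_isRoot.2 hQ₁r
  have hfac : Pbar = (X ^ 2 + 1) * Q₂ := by
    rw [hQ₁, hQ₂, ← mul_assoc]
    congr 1
    have e : (X - C s) * (X - C (-s)) = X ^ 2 - C (s ^ 2) := by rw [C_pow, map_neg]; ring
    rw [e, hs, map_neg, map_one, sub_neg_eq_add]
  -- lift `Q₂` to `ℤ[X]`; the difference is divisible by `p`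
  obtain ⟨Q, rfl⟩ := map_surjective (Int.castRingHom (ZMod p)) (ZMod.ringHom_surjective _) Q₂
  have hdiff : (P - (X ^ 2 + 1) * Q).map (Int.castRingHom (ZMod p)) = 0 := by
    rw [Polynomial.map_sub, Polynomial.map_mul, ← hPbar, hfac]
    simp
  have hdvd : C (p : ℤ) ∣ P - (X ^ 2 + 1) * Q := by
    rw [C_dvd_iff_dvd_coeff]
    intro i
    have hi := congrArg (fun q : (ZMod p)[X] => q.coeff i) hdiff
    simp only [coeff_map, coeff_zero, eq_intCast] at hi
    exact (ZMod.intCast_zmod_eq_zero_iff_dvd _ p).1 hi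
  obtain ⟨R, hR⟩ := hdvd
  have hP : P = (X ^ 2 + 1) * Q + C (p : ℤ) * R := by rw [← hR]; ring
  -- `p = g^{p-1} ε = g · (g^{p-2} ε)`
  have hpg := prime_eq_pow_mul hp hp2
  refine ⟨AdjoinRoot.mk _ Q + (1 + AdjoinRoot.root (cyclotomic (4 * p) ℤ) ^ 2) ^ (p - 2) *
    (∏ j ∈ Finset.range (p - 1), ∑ m ∈ Finset.range (j + 1), (-(AdjoinRoot.root (cyclotomic (4 * p) ℤ)) ^ 2) ^ m) *
    AdjoinRoot.mk _ R, ?_⟩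
  rw [hP, map_add, map_mul, map_mul, map_add, map_pow, AdjoinRoot.mk_X, map_one, AdjoinRoot.mk_C, map_natCast,
    hpg]
  have hsplit : (1 + AdjoinRoot.root (cyclotomic (4 * p) ℤ) ^ 2) ^ (p - 1) =
      (1 + AdjoinRoot.root (cyclotomic (4 * p) ℤ) ^ 2) ^ (p - 2) * (1 + AdjoinRoot.root (cyclotomic (4 * p) ℤ) ^ 2) := by
    rw [← pow_succ]; congr 1; have := hp.two_le; omega
  rw [hsplit]
  ring

end Reduction

end Literature.NumberTheory.NumberFields.CyclotomicFourP

end
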